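import Summits.Parity.GeneralizedHardyLittlewood.Theorems.LiouvilleShiftedTablesDefs
import Literature.NumberTheory.Sieve.DrappeauDispersionLemmas
import Literature.NumberTheory.Sieve.DivisorPowerSums
import Mathlib.NumberTheory.Harmonic.Bounds

/-!
# The peel, part 1/6: the peeled objects and THE PEEL identity

Route `LiouvilleShiftedTables` (Parity / GeneralizedHardyLittlewood), crux `TypeI2Dilated` (stmt-Parity-14272),
line `peel-to-drappeau`, registered stub `stub_peel : PeelStep` (`PeelStep := DrappeauTypeII → DilatedTypeIICore`,
vocabulary in `…Theorems.LiouvilleShiftedTablesDefs`).  THE PEEL moves the two rough moduli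
(`r` and the dilation `q`, both `≤ x^ρ`) and their classes onto the coefficients, so that Drappeau's
hypothesis-free Theorem 5.1 (S. Drappeau, Proc. LMS 114 (2017), arXiv:1504.05549, §5 — the Literature named
fact `Drappeau2017_theorem51`, taken as the hypothesis `DrappeauTypeII`) applies on the smooth modulus `s` alone:
CRT class `e mod lcm(q, r)` → `g ∣ mh` × a unit class expanded in characters `ξ mod L'` (absorbed into `α`, `β`),
the `(qr)^∞`-part `h` of the `β`-variable split off (`h ≤ x^{6ρ₀}`: Theorem 5.1 at `x' = MN/h` with
`a₁ = c·qr`, `a₂ = h·qr`; `h > x^{6ρ₀}`: the trivial bound (5.2) and `∑_{h ∣ (qr)^∞} h^{-1/2} ≤ τ(qr)²`),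
`ρ₀ = min(δ_{5.1}(η/2), η)/100`.  Everything here is PROVED; the only non-Mathlib inputs are the Literature
lemmas `Literature.NumberTheory.Sieve.DrappeauDispersionLemmas` (all proved) and the divisor bound
(`DivisorBound`, `DivisorPowerSums`).

The chain (each file imports the previous one):
* part 1: the peeled objects and THE PEEL identity (`…TypeI2DilatedPeel1`)
* part 2: matching Theorem 5.1; bounds for the peeled coefficients and blocks (`…TypeI2DilatedPeel2`)
* part 3: CRT, from blocks to the pair, and the main blocks via Theorem 5.1 (`…TypeI2DilatedPeel3`)
* part 4: the per-pair bound (`…TypeI2DilatedPeel4`)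
* part 5: the crux sum at one height `x` (`…TypeI2DilatedPeel5`)
* part 6: constants, thresholds and `stub_peel` (`…TypeI2DilatedPeel6`)

[this line; cite: Drappeau2017, Thm 5.1, §5 (5.1)–(5.2)]
-/

noncomputable section

namespace Summit.Parity.GeneralizedHardyLittlewood.Cruxes.TypeI2Dilated.PeelToDrappeau

open Finset Real
open scoped ArithmeticFunction.sigma Classical
open Literature.NumberTheory.Sieve Literature.NumberTheory.Sieve.Drappeau2017

/-! ### THE PEEL — proof map and constants

Given `hD : DrappeauTypeII`, `c ≠ 0`, `0 < η ≤ 1/12`: take `δ = δ_{5.1}(η/2)` and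
`ρ₀ := min(δ, η)/100`; for `0 < ρ ≤ ρ₀`, `K ≥ 0` take `(C₅, c₀, x₅)` from Theorem 5.1 at `A = K`.
For `x ≥ x₀` and a pair `(q, r)` (`q ≤ x^ρ`, `r ≤ R ≤ x^ρ`, `P := qr ≤ x^{2ρ}`):
* CRT (`crt_reduce`): the two classes are one class `e mod L`, `L = lcm(q, r)`, or the pair contributes `0`;
* `g := (e, L)`, `L' := L/g`, `e' := e/g` (unit mod `L'`): `mn ≡ e (L) ⇔ g ∣ mn ∧ mn/g ≡ e' (L')`
  (`Drappeau2017.natCast_eq_iff_gcd_dvd`), and `1_{k ≡ e' (L')} = φ(L')⁻¹ ∑_{ξ mod L'} ξ(ē') ξ(k)`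
  (`Drappeau2017.indicator_eq_sum_char`);
* the `β`-variable is sorted by its `P^∞`-part `h` (`sum_dyadic_eq_sum_hSet`): `n = h n''`, `(n'', P) = 1`,
  so `g ∣ m h n'' ⇔ g ∣ m h` and the class indicator peels into `α^{(h,ξ)}(m) = 1_{g∣mh} ξ(mh/g) α(m)`,
  `β^{(h,ξ)}(n'') = ξ(n'') β(h n'')` (`indicator_peel`, `TL_eq_sum`);
* for `h ≤ H := x^{6ρ₀}`: Theorem 5.1 at `x' = M · (N/h)`, `S = Slo`, `a₁ = c·P`, `a₂ = h·P`
  (`(s, a₁a₂) = 1 ⇔ s ∈ sRange`, `(n'', a₂) = 1 ⇔ (n'', P) = 1`, `m n'' ā₁ a₂ = m h n'' c̄`; `sum_Eblock_eq`,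
  `main_block_bound`), giving `τ(h)^K C₅ x' (log x')^{c₀}/Rd ≤ C₁ Λ₁ MN h^{-1/2}/Rd` with
  `C₁ = C_a^K` (`τ ≤ C_a n^{1/(2K+2)}`), `Λ₁ = |C₅| (log 256x)^{|c₀|} ≤ |C₅| C₃ x^ρ`, `C₃ = 256((|c₀|+1)/ρ)^{|c₀|}`;
* for `h > H`: `|𝔲_{Rd}(t; s)| ≤ 1_{t=1} + Rd τ(s)²/s` (`norm_uR_le`), `#{s : s ∣ k − c} ≤ τ(|k − c|)`,
  `τ ≤ D := C_τ (2048x)^{ρ₀/(8K+8)}` on `[1, 2048x]`: `≤ 4 MN D^{2K}(D + Rd D²(1 + log x)) H^{-1/2} h^{-1/2}`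
  (`tail_block_bound`, `sum_norm_Fker_le`), and `4 D^{2K}(…) H^{-1/2} ≤ C₄/Rd`, `C₄ = 16384 C_τ^{2K+2}(1 + 4/ρ₀)`
  (`tail_bracket_le`);
* `∑_{h ∣ P^∞} h^{-1/2} ≤ 4^{ω(P)} ≤ τ(P)² ≤ C₂² x^ρ` (`sum_hSet_rpow_le`, `τ ≤ C₂ n^{1/4}`), `#pairs ≤ x^{2ρ}`;
* total `≤ 256 C₂² (C₁ |C₅| C₃ + C₄) · x^{1+4ρ}/Rd =: C x^{1+4ρ}/Rd` (`peel_at`, `final_algebra`), where `x₀` is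
  where seven inequalities `const ≤ x^{b}` (`b > 0`) start to hold (`stub_peel`). -/

/-! ### The `P^∞`-parts `h` -/

/-- The index set of the `P^∞`-parts: `1 ≤ h ≤ B` composed of primes dividing `P`. [folklore] -/
def hSet (P B : ℕ) : Finset ℕ := (Icc 1 B).filter (fun h => h.primeFactors ⊆ P.primeFactors)

/-- Membership in `hSet`. [folklore] -/
theorem mem_hSet {P B h : ℕ} : h ∈ hSet P B ↔ (1 ≤ h ∧ h ≤ B) ∧ h.primeFactors ⊆ P.primeFactors := by
  simp [hSet]

/-- **Sorting `n ∼ N` by its `P^∞`-part** (`Drappeau2017.sum_dyadic_eq_sum_filter_primeFactors` in the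
`hSet` notation): `∑_{n ∼ N} G(n) = ∑_{h ∈ hSet P B} ∑_{n'' ∼ N/h, (n'', P) = 1} G(h n'')`, `B ≥ 2N`.
[folklore] -/
theorem sum_dyadic_eq_sum_hSet {P : ℕ} (hP : P ≠ 0) {N : ℝ} (hN : 0 ≤ N) {B : ℕ} (hB : ⌊2 * N⌋₊ ≤ B)
    (G : ℕ → ℂ) :
    ∑ n ∈ BFI.dyadic N, G n =
      ∑ h ∈ hSet P B, ∑ n ∈ (BFI.dyadic (N / h)).filter (fun n => n.Coprime P), G (h * n) :=
  sum_dyadic_eq_sum_filter_primeFactors hP hN hB G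

/-- **The `h`-sums are harmless** (`Drappeau2017.sum_filter_primeFactors_rpow_le` in the `hSet`
notation): `∑_{h ∈ hSet P B} h^{-1/2} ≤ τ(P)²`. [folklore] -/
theorem sum_hSet_rpow_le {P : ℕ} (hP : P ≠ 0) (B : ℕ) :
    ∑ h ∈ hSet P B, (h : ℝ) ^ (-(1 / 2 : ℝ)) ≤ (σ 0 P : ℝ) ^ 2 :=
  sum_filter_primeFactors_rpow_le hP B

/-! ### The per-pair objects and THE PEEL identity -/

/-- The kernel of the crux sum at the smooth modulus `s`: `F(s, k) = 𝔲_{Rd}(k c̄; s)`. [this line] -/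
def Fker (c : ℤ) (Rd : ℝ) (s k : ℕ) : ℂ := uR Rd s (((k : ℕ) : ZMod s) * ((c : ZMod s))⁻¹)

/-- The per-pair sum with ONE class condition `mn ≡ e (mod L)` (after CRT). [this line] -/
def TL (c : ℤ) (Rd : ℝ) (q r : ℕ) (Slo M N : ℝ) (α β : ℕ → ℂ) (L e : ℕ) : ℂ :=
  ∑ s ∈ sRange c q r Slo (2 * Slo), ∑ m ∈ BFI.dyadic M, ∑ n ∈ BFI.dyadic N,
    if ((m * n : ℕ) : ZMod L) = ((e : ℕ) : ZMod L) then α m * β n * Fker c Rd s (m * n) else 0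

/-- The peeled `α`-coefficient: `α^{(h,ξ)}(m) = 1_{g ∣ mh} ξ(mh/g) α(m)`. [this line] -/
def aCoef (α : ℕ → ℂ) (g h L' : ℕ) (ξ : DirichletCharacter ℂ L') (m : ℕ) : ℂ :=
  (if g ∣ m * h then ξ ((m * h / g : ℕ) : ZMod L') else 0) * α m

/-- The peeled `β`-coefficient: `β^{(h,ξ)}(n) = ξ(n) β(hn)`. [this line] -/
def bCoef (β : ℕ → ℂ) (h L' : ℕ) (ξ : DirichletCharacter ℂ L') (n : ℕ) : ℂ :=
  ξ ((n : ℕ) : ZMod L') * β (h * n)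

/-- The peeled bilinear block at the smooth modulus `s`:
`E(h, ξ, s) = ∑_{m ∼ M} ∑_{n ∼ N/h, (n, P) = 1} α^{(h,ξ)}(m) β^{(h,ξ)}(n) F(s, m h n)`. [this line] -/
def Eblock (c : ℤ) (Rd : ℝ) (M N : ℝ) (α β : ℕ → ℂ) (P g h L' : ℕ) (ξ : DirichletCharacter ℂ L')
    (s : ℕ) : ℂ :=
  ∑ m ∈ BFI.dyadic M, ∑ n ∈ (BFI.dyadic (N / h)).filter (fun n => n.Coprime P),
    aCoef α g h L' ξ m * bCoef β h L' ξ n * Fker c Rd s (m * (h * n))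

/-- **The class indicator, peeled**: for `(n, P) = 1`, `g = (e, L)`, `L ∣ P`, `L' = L/g`, `e' = e/g`:
`1_{m h n ≡ e (L)} = 1_{g ∣ mh} · φ(L')⁻¹ ∑_{ξ mod L'} ξ(ē') ξ(mh/g) ξ(n)`. [this line] -/
theorem indicator_peel {P L e g L' e' : ℕ} (hL : 0 < L) (hLP : L ∣ P) (hg : g = Nat.gcd e L)
    (hL' : L' = L / g) (he' : e' = e / g) (m h : ℕ) {n : ℕ} (hnP : n.Coprime P) :
    (if ((m * (h * n) : ℕ) : ZMod L) = ((e : ℕ) : ZMod L) then (1 : ℂ) else 0) =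
      ∑ ξ : DirichletCharacter ℂ L',
        (((Nat.totient L' : ℂ))⁻¹ * ξ ((e' : ZMod L'))⁻¹) *
          ((if g ∣ m * h then ξ ((m * h / g : ℕ) : ZMod L') else 0) * ξ ((n : ℕ) : ZMod L')) := by
  have hg0 : 0 < g := by rw [hg]; exact Nat.gcd_pos_of_pos_right _ hL
  have hgL : g ∣ L := by rw [hg]; exact Nat.gcd_dvd_right e L
  have hL'0 : 0 < L' := by rw [hL']; exact Nat.div_pos (Nat.le_of_dvd hL hgL) hg0
  have hcop : e'.Coprime L' := by rw [he', hL', hg]; exact coprime_div_gcd_div_gcd' hL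
  -- `g` is coprime to `n`
  have hgn : g.Coprime n :=
    (Nat.Coprime.coprime_dvd_left (hgL.trans hLP) hnP.symm)
  have key := natCast_eq_iff_gcd_dvd (e := e) hL (m * (h * n))
  rw [← hg, ← hL', ← he'] at key
  by_cases hdiv : g ∣ m * h
  · have hdiv' : g ∣ m * (h * n) := by rw [← mul_assoc]; exact hdiv.mul_right n
    have hquot : m * (h * n) / g = (m * h / g) * n := by
      rw [← mul_assoc, Nat.div_mul_right_comm hdiv]  -- (m*h*n)/g = (m*h)/g * n
    simp only [if_pos hdiv]
    rw [show (if ((m * (h * n) : ℕ) : ZMod L) = ((e : ℕ) : ZMod L) then (1 : ℂ) else 0) =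
        (if (((m * h / g) * n : ℕ) : ZMod L') = ((e' : ℕ) : ZMod L') then (1 : ℂ) else 0) by
      refine if_congr ?_ rfl rfl
      rw [key, hquot]
      exact ⟨fun h => h.2, fun h => ⟨hdiv', h⟩⟩]
    rw [indicator_eq_sum_char hL'0 hcop, Finset.mul_sum]
    refine Finset.sum_congr rfl fun ξ _ => ?_
    push_cast
    rw [map_mul]
    ring
  · have hndiv : ¬ g ∣ m * (h * n) := by
      rw [← mul_assoc]
      exact fun h' => hdiv (hgn.dvd_of_dvd_mul_right h')
    simp only [if_neg hdiv, zero_mul, mul_zero, Finset.sum_const_zero]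
    rw [if_neg]
    rw [key]
    exact fun h' => hndiv h'.1

/-- **THE PEEL identity** (per pair `(q, r)`, class `e mod L`, `L = lcm(q, r)`):
`T_L = ∑_{h ∣ (qr)^∞} ∑_{ξ mod L'} φ(L')⁻¹ ξ(ē') ∑_{s} E(h, ξ, s)`. [this line] -/
theorem TL_eq_sum (c : ℤ) (Rd : ℝ) {q r : ℕ} (hq : 0 < q) (hr : 0 < r) (Slo : ℝ) {M N : ℝ}
    (hN : 0 ≤ N) (α β : ℕ → ℂ) {L e g L' e' B : ℕ} (hLdef : L = Nat.lcm q r)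
    (hg : g = Nat.gcd e L) (hL' : L' = L / g) (he' : e' = e / g) (hB : ⌊2 * N⌋₊ ≤ B) :
    TL c Rd q r Slo M N α β L e =
      ∑ h ∈ hSet (q * r) B, ∑ ξ : DirichletCharacter ℂ L',
        (((Nat.totient L' : ℂ))⁻¹ * ξ ((e' : ZMod L'))⁻¹) *
          ∑ s ∈ sRange c q r Slo (2 * Slo), Eblock c Rd M N α β (q * r) g h L' ξ s := by
  have hP : q * r ≠ 0 := (Nat.mul_pos hq hr).ne'
  have hL : 0 < L := by rw [hLdef]; exact Nat.lcm_pos hq hr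
  have hLP : L ∣ q * r := by rw [hLdef]; exact Nat.lcm_dvd_mul q r
  -- Step A/B: rewrite each inner `n`-sum
  have inner : ∀ s m : ℕ,
      (∑ n ∈ BFI.dyadic N,
        (if ((m * n : ℕ) : ZMod L) = ((e : ℕ) : ZMod L) then α m * β n * Fker c Rd s (m * n) else 0)) =
      ∑ h ∈ hSet (q * r) B, ∑ ξ : DirichletCharacter ℂ L',
        ∑ n ∈ (BFI.dyadic (N / h)).filter (fun n => n.Coprime (q * r)),
          (((Nat.totient L' : ℂ))⁻¹ * ξ ((e' : ZMod L'))⁻¹) *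
            (aCoef α g h L' ξ m * bCoef β h L' ξ n * Fker c Rd s (m * (h * n))) := by
    intro s m
    rw [sum_dyadic_eq_sum_hSet hP hN hB]
    refine Finset.sum_congr rfl fun h _ => ?_
    rw [Finset.sum_comm]
    refine Finset.sum_congr rfl fun n hn => ?_
    have hnP : n.Coprime (q * r) := (Finset.mem_filter.1 hn).2
    rw [← boole_mul, indicator_peel hL hLP hg hL' he' m h hnP, Finset.sum_mul]
    refine Finset.sum_congr rfl fun ξ _ => ?_
    simp only [aCoef, bCoef]
    ring
  -- Step C: reorder the sums
  unfold TL Eblock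
  simp_rw [inner]
  -- now LHS = ∑ s, ∑ m, ∑ h, ∑ ξ, ∑ n, w * X and RHS = ∑ h, ∑ ξ, w * ∑ s, ∑ m, ∑ n, X
  simp_rw [Finset.mul_sum]
  refine (Finset.sum_congr rfl fun s _ => Finset.sum_comm).trans ?_
  refine Finset.sum_comm.trans ?_
  refine Finset.sum_congr rfl fun h _ => ?_
  refine (Finset.sum_congr rfl fun s _ => Finset.sum_comm).trans ?_
  exact Finset.sum_comm

/-- Landing anchor of the split peel chain (file 1 of 6): a registered, mathematically vacuous sub-goal
(`ledger workitem stub-add … --name peelChain1_anchor --signature 'True'`) so that this intermediate file passes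
the gate's supports check; the registered stub `stub_peel` is proved in file 6. [this line] -/
theorem peelChain1_anchor : True := trivial

end Summit.Parity.GeneralizedHardyLittlewood.Cruxes.TypeI2Dilated.PeelToDrappeau

end
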